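import Mathlib
import Literature.Computability.AlgebraicComplexity.GroupTheoreticMatMul
import Literature.Computability.AlgebraicComplexity.STPPTranslation

/-!
# Global B-shift / C-shift invariance of STPP families (census convention `IsSTPP`)

Companion to `IsSTPP.translate` (per-member common translations).  In the defining word
`(s′ − s) + (t′ − t) + (u′ − u)` the two `B`-elements enter with opposite signs, and so do the two
`C`-elements; hence translating ALL `B`-sets by one element `β` and ALL `C`-sets by one element `γ`
preserves the property.  Together with `IsSTPP.translate` this is the full translation symmetry used by
the cell's SAT encodings to normalise `0 ∈ A_t` for every `t`, `0 ∈ B_{t₀}`, `0 ∈ C_{t₀}`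
(planner mm-stpp gen 8, SUCCESSOR-BRIEF §2).  [cite: CohnKleinbergSzegedyUmans2005, Def. 5.1]
-/

namespace Literature.Computability.AlgebraicComplexity

open Finset

variable {H : Type*} [AddCommGroup H] [DecidableEq H]

/-- **Global `B`/`C` shift invariance of the STPP** (census convention): if `(Aᵢ, Bᵢ, Cᵢ)ᵢ` is an STPP
family then so is `(Aᵢ, Bᵢ + β, Cᵢ + γ)ᵢ` for any two elements `β γ : H` (the SAME `β` for every member,
the same `γ` for every member). [cite: CohnKleinbergSzegedyUmans2005, Def. 5.1] -/
theorem IsSTPP.shiftBC {N : ℕ} {A B C : Fin N → Finset H} (h : IsSTPP A B C) (β γ : H) :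
    IsSTPP A (fun i => (B i).image (· + β)) (fun i => (C i).image (· + γ)) := by
  intro i j k s hs s' hs' t ht t' ht' u hu u' hu' he
  obtain ⟨b, hb, rfl⟩ := Finset.mem_image.1 ht
  obtain ⟨b', hb', rfl⟩ := Finset.mem_image.1 ht'
  obtain ⟨c, hc, rfl⟩ := Finset.mem_image.1 hu
  obtain ⟨c', hc', rfl⟩ := Finset.mem_image.1 hu'
  have key : (s' - s) + (b' - b) + (c' - c) = 0 := by
    rw [← he]; abel
  obtain ⟨hij, hjk, e1, e2, e3⟩ := h i j k s hs s' hs' b hb b' hb' c hc c' hc' key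
  exact ⟨hij, hjk, e1, by rw [e2], by rw [e3]⟩

/-- Normalisation corollary used by the SAT encodings: translating member `i` by `tᵢ`, then all `B`-sets
by `β` and all `C`-sets by `γ`, preserves the STPP. [cite: CohnKleinbergSzegedyUmans2005, Def. 5.1] -/
theorem IsSTPP.translate_shiftBC {N : ℕ} {A B C : Fin N → Finset H} (h : IsSTPP A B C)
    (t : Fin N → H) (β γ : H) :
    IsSTPP (fun i => (A i).image (· + t i)) (fun i => ((B i).image (· + t i)).image (· + β))
      (fun i => ((C i).image (· + t i)).image (· + γ)) :=
  (h.translate t).shiftBC β γ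

end Literature.Computability.AlgebraicComplexity
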